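import Literature.Barriers.CriticalPhenomena.NoExactVertexRelationZ2Stiffness
import HarnessLib

/-!
# The anti-diagonal of the stiffness deformation is the uniform walk two spin units up

Companion to `Literature.Barriers.CriticalPhenomena.NoExactVertexRelationZ2Stiffness` (same
catalogue entry, sub-problem `SAWScalingLimit`). That file types the two-fugacity (stiffness)
deformation of the square-lattice SAW parafermionic observable — weight `u` per TURNING vertex,
`v` per vertex crossed STRAIGHT, spin `σ` — and proves `NoExactVertexRelationZ2Stiffness`:
no exact single-vertex relation for `u v ≠ 0`, `u² ≠ v²`; its `scope_caveats (a)` records that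
"the anti-diagonal `u = -v` … [is] not treated".

This file settles the anti-diagonal by a one-line dictionary which is a general fact about
nearest-neighbour paths of `ℤ²`: **the number of turning vertices and the winding in quarter
turns have the same parity** (every turn is `±π/2`, a straight passage is `0`), hence
`(-1)^{#turns} = e^{-2iW}` walk by walk, and therefore, for EVERY `v : ℂ` and every spin `σ`,

  `stiffnessHalfEdgeTerm Ω δ a (-v) v σ z w = stiffnessHalfEdgeTerm Ω δ a v v (σ + 2) z w`

(`stiffnessHalfEdgeTerm_antidiag`, for `δ ≠ 0` and a lattice edge `{z, w}`): the point
`(u, v) = (-v, v)` of the stiffness deformation IS the uniform walk of fugacity `v` at the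
shifted spin `σ + 2` (the "spin dictionary" `σ ↦ σ + 2`, `y ↦ -y` of the lane's search
protocol, here for the turn-signed walk). Consequences:

* `exactVertexRelationZ2Stiffness_antidiag_iff`: `ExactVertexRelationZ2Stiffness (-v) v σ c ↔
  ExactVertexRelationZ2Stiffness v v (σ + 2) c` (all `v : ℂ`, `σ : ℝ`, `c`);
* `exactVertexRelationZ2Stiffness_antidiag_iff_exactVertexRelationZ2`: for real `x ≠ 0`,
  `ExactVertexRelationZ2Stiffness (-x) x σ c ↔ ExactVertexRelationZ2 x (σ + 2) c` (Appendix A's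
  class of `NienhuisWeightsExcludeVertexSAW`);
* **`exactVertexRelationZ2Stiffness_eq_zero_antidiag`**: for `0 < x < 1` and every real `σ`,
  `ExactVertexRelationZ2Stiffness (-x) x σ c → c = 0` (by Appendix A, `exactVertexRelationZ2_eq_zero`,
  at the spin `σ + 2`) — discharging the anti-diagonal half `{u = -v, v ∈ (0,1)}` of the caveat;
* `exactVertexRelationZ2Stiffness_eq_zero_of_sq_ne_or_antidiag`: the class is empty on
  `{u v ≠ 0, u² ≠ v²} ∪ {(-x, x) : 0 < x < 1}` (with `NoExactVertexRelationZ2Stiffness_holds`).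

Why the lane wants it on record (venture lane «pcv-sawmu», Tier B, `Z2-SEARCH-PROTOCOL.md` §4.3 /
§6 P-T): Engine C's certified elimination for the class `S-Z2-T` (leg E, P-T MET at every
`y = ζ_N^j`, `N ≤ 240`) covers the two lines `u = ±v` that the range-free theorem excludes; this
dictionary says the line `u = -v` carries exactly the identities of the uniform walk at `-y`, so
nothing new can live there. (A sibling fact — per root and target half-edge the winding in
quarter turns is constant mod 4 — is why every certificate of that search depends on `y⁴` only;
it is not needed here.)

Sources, as printed, for the objects (no new cited statement is introduced here):
[cite: DuminilCopinSmirnov2012, Def. 1 (shape of the observable; winding "total rotation of the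
direction in radians")]; [cite: Glazman2015WeightedSAW, Lemma 3.1 (the weighted walks; the
`σ`-classification)]. Everything proved below is [folklore] lattice geometry.
-/

noncomputable section

open Complex Literature.Probability.LatticeModels Literature.Probability.Percolation

namespace Literature.Barriers.CriticalPhenomena

namespace NoVertexRelationStiffness

open NoVertexRelation Literature.Probability.RandomPlanarGeometry.SAW

/-! ### Lattice steps: turn indicator versus signed quarter turn -/

/-- For two unit steps that are not opposite, the signed quarter turn is `0` exactly when the
steps are equal, and `±1` otherwise. [folklore] -/
private theorem turnZ_eq_zero_iff_of_isUnitStep {d₁ d₂ : ZZ} (h₁ : IsUnitStep d₁) (h₂ : IsUnitStep d₂)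
    (h : dotZ d₁ d₂ ≠ -1) : (turnZ d₁ d₂ = 0 ↔ d₂ = d₁) ∧ (d₂ ≠ d₁ → turnZ d₁ d₂ = 1 ∨ turnZ d₁ d₂ = -1) := by
  rcases h₁ with rfl | rfl | rfl | rfl <;> rcases h₂ with rfl | rfl | rfl | rfl <;>
    simp [dotZ, turnZ] at h ⊢

/-- Two unit steps with dot product `-1` are opposite. [folklore] -/
private theorem eq_neg_of_dotZ_eq_neg_one {d₁ d₂ : ZZ} (h₁ : IsUnitStep d₁) (h₂ : IsUnitStep d₂)
    (h : dotZ d₁ d₂ = -1) : d₂ = (-d₁.1, -d₁.2) := by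
  rcases h₁ with rfl | rfl | rfl | rfl <;> rcases h₂ with rfl | rfl | rfl | rfl <;>
    simp [dotZ] at h ⊢

/-- The straightness test of `turnCount`/`straightCount` in integer coordinates. [folklore] -/
private theorem sub_eq_sub_iff_dirOf (p q r : Site 2) :
    r - q = q - p ↔ dirOf (ofSite q) (ofSite r) = dirOf (ofSite p) (ofSite q) := by
  constructor
  · intro h
    have h0 := congrFun h 0
    have h1 := congrFun h 1
    simp only [Pi.sub_apply] at h0 h1
    simp [dirOf, ofSite, h0, h1]
  · intro h
    simp only [dirOf, ofSite, Prod.mk.injEq] at h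
    funext i
    fin_cases i <;> simp [h.1, h.2]

/-- Adjacent sites of `ℤ²` differ by a unit step (integer coordinates). [folklore] -/
private theorem isUnitStep_dirOf_of_adj {x y : Site 2} (h : (zdGraph 2).Adj x y) :
    IsUnitStep (dirOf (ofSite x) (ofSite y)) := by
  rw [zdGraph_adj_iff] at h
  obtain ⟨i, h | h⟩ := h
  · subst h
    fin_cases i
    · left; simp [dirOf, ofSite]
    · right; left; simp [dirOf, ofSite]
  · subst h
    fin_cases i
    · right; right; left; simp [dirOf, ofSite]
    · right; right; right; simp [dirOf, ofSite]

/-- A unit step followed by a unit step back returns to the start. [folklore] -/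
private theorem eq_of_dotZ_eq_neg_one {p q r : Site 2} (h₁ : IsUnitStep (dirOf (ofSite p) (ofSite q)))
    (h₂ : IsUnitStep (dirOf (ofSite q) (ofSite r)))
    (h : dotZ (dirOf (ofSite p) (ofSite q)) (dirOf (ofSite q) (ofSite r)) = -1) : r = p := by
  have key := eq_neg_of_dotZ_eq_neg_one h₁ h₂ h
  simp only [dirOf, ofSite, Prod.mk.injEq] at key
  funext i
  fin_cases i
  · show r 0 = p 0
    linarith [key.1]
  · show r 1 = p 1
    linarith [key.2]

/-! ### Parity of turns = parity of quarter windings -/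

/-- **`(-1)^{#turns} = e^{-iπ·(quarter turns)}`** for a lattice polyline with unit steps and no
reversal: each turning vertex contributes `±1` quarter turn and a factor `-1`, each straight
vertex `0` and `+1`. [folklore] -/
private theorem neg_one_pow_turnCount : ∀ (l : List (Site 2)), goodSteps (l.map ofSite) = true →
    ((-1 : ℂ) ^ turnCount l) = Complex.exp (-(Real.pi * Complex.I) * (quarterTurns (l.map ofSite) : ℂ))
  | [], _ => by simp [turnCount, quarterTurns]
  | [_], _ => by simp [turnCount, quarterTurns]
  | [_, _], _ => by simp [turnCount, quarterTurns]
  | p :: q :: r :: l, h => by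
    have h' : goodSteps (ofSite p :: ofSite q :: ofSite r :: l.map ofSite) = true := by
      simpa using h
    obtain ⟨h₁, hdot, hrest⟩ := goodSteps_cons_cons_cons h'
    have h₂ : IsUnitStep (dirOf (ofSite q) (ofSite r)) := goodSteps_isUnitStep hrest
    have ih := neg_one_pow_turnCount (q :: r :: l) (by simpa using hrest)
    simp only [List.map_cons] at ih
    have hstep : ((-1 : ℂ) ^ (if r - q = q - p then 0 else 1)) =
        Complex.exp (-(Real.pi * Complex.I) * (turnZ (dirOf (ofSite p) (ofSite q)) (dirOf (ofSite q) (ofSite r)) : ℂ)) := by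
      obtain ⟨hiff, hne⟩ := turnZ_eq_zero_iff_of_isUnitStep h₁ h₂ hdot
      by_cases hs : r - q = q - p
      · have hd : dirOf (ofSite q) (ofSite r) = dirOf (ofSite p) (ofSite q) := (sub_eq_sub_iff_dirOf p q r).1 hs
        rw [if_pos hs, hiff.2 hd]
        simp
      · have hd : dirOf (ofSite q) (ofSite r) ≠ dirOf (ofSite p) (ofSite q) :=
          fun hd => hs ((sub_eq_sub_iff_dirOf p q r).2 hd)
        rw [if_neg hs, pow_one]
        rcases hne hd with ht | ht
        · rw [ht, Int.cast_one, mul_one, Complex.exp_neg, Complex.exp_pi_mul_I]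
          norm_num
        · rw [ht, Int.cast_neg, Int.cast_one, mul_neg, mul_one, neg_neg, Complex.exp_pi_mul_I]
    show ((-1 : ℂ) ^ ((if r - q = q - p then 0 else 1) + turnCount (q :: r :: l))) =
      Complex.exp (-(Real.pi * Complex.I) *
        ((turnZ (dirOf (ofSite p) (ofSite q)) (dirOf (ofSite q) (ofSite r)) + quarterTurns (ofSite q :: ofSite r :: l.map ofSite) : ℤ) : ℂ))
    rw [pow_add, hstep, ih, ← Complex.exp_add, Int.cast_add]
    ring_nf

/-! ### Windings of mesh polylines: scale invariance -/

/-- The turning angle is invariant under a non-zero complex dilation. [folklore] -/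
private theorem turning_mul (κ : ℂ) (hκ : κ ≠ 0) (z₁ z₂ z₃ : ℂ) :
    turning (κ * z₁) (κ * z₂) (κ * z₃) = turning z₁ z₂ z₃ := by
  unfold turning
  rw [← mul_sub, ← mul_sub, mul_div_mul_left _ _ hκ]

/-- The winding is invariant under a non-zero complex dilation. [folklore] -/
private theorem winding_map_mul (κ : ℂ) (hκ : κ ≠ 0) : ∀ (l : List ℂ),
    winding (l.map fun z => κ * z) = winding l
  | [] => by simp
  | [_] => by simp
  | [_, _] => by simp
  | z₁ :: z₂ :: z₃ :: l => by
    have ih := winding_map_mul κ hκ (z₂ :: z₃ :: l)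
    simp only [List.map_cons, winding_cons_cons_cons] at ih ⊢
    rw [ih, turning_mul κ hκ]

/-- Mesh points scale linearly in the mesh. [folklore] -/
private theorem meshPoint_eq_mul_meshPoint_one (δ : ℝ) (s : Site 2) :
    meshPoint δ s = (δ : ℂ) * meshPoint 1 s := by
  simp [meshPoint]

/-- Medial points scale linearly in the mesh. [folklore] -/
private theorem medialPoint_eq_mul_medialPoint_one (δ : ℝ) (z w : Site 2) :
    medialPoint δ s(z, w) = (δ : ℂ) * medialPoint 1 s(z, w) := by
  rw [medialPoint_mk, medialPoint_mk, meshPoint_eq_mul_meshPoint_one δ z,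
    meshPoint_eq_mul_meshPoint_one δ w]
  ring

/-- The winding of the mesh polyline of a walk continued to the middle of `{z, w}` does not
depend on the mesh `δ ≠ 0`. [folklore] -/
private theorem winding_support_medial_eq_one {G : SimpleGraph (Site 2)} {a z : Site 2} (p : G.Walk a z)
    (w : Site 2) {δ : ℝ} (hδ : δ ≠ 0) :
    winding (p.support.map (meshPoint δ) ++ [medialPoint δ s(z, w)]) =
      winding (p.support.map (meshPoint 1) ++ [medialPoint 1 s(z, w)]) := by
  have hκ : (δ : ℂ) ≠ 0 := Complex.ofReal_ne_zero.2 hδ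
  have hl : p.support.map (meshPoint δ) ++ [medialPoint δ s(z, w)] =
      (p.support.map (meshPoint 1) ++ [medialPoint 1 s(z, w)]).map fun x => (δ : ℂ) * x := by
    rw [List.map_append, List.map_map, List.map_cons, List.map_nil,
      ← medialPoint_eq_mul_medialPoint_one]
    congr 1
    apply List.map_congr_left
    intro s _
    exact meshPoint_eq_mul_meshPoint_one δ s
  rw [hl, winding_map_mul _ hκ]

/-! ### Lattice paths have unit steps and no reversal -/

/-- The integer-coordinate step list of a self-avoiding lattice walk continued along a fresh
lattice edge `{z, w}` passes the `goodSteps` test (unit steps, no immediate reversal).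
[folklore] -/
private theorem goodSteps_support_of_isPath {G : SimpleGraph (Site 2)} (hG : G ≤ zdGraph 2)
    {a z : Site 2} (p : G.Walk a z) (w : Site 2) (hzw : (zdGraph 2).Adj z w) :
    p.IsPath → s(z, w) ∉ p.edges → goodSteps (p.support.map ofSite ++ [ofSite w]) = true := by
  induction p with
  | nil =>
    intro _ _
    simpa [goodSteps] using isUnitStep_dirOf_of_adj hzw
  | @cons a' b z' hab q ih =>
    intro hp he
    have hu₁ : IsUnitStep (dirOf (ofSite a') (ofSite b)) := isUnitStep_dirOf_of_adj (hG hab)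
    rw [SimpleGraph.Walk.cons_isPath_iff] at hp
    have he' : s(z', w) ∉ q.edges := by
      intro h'
      apply he
      rw [SimpleGraph.Walk.edges_cons]
      exact List.mem_cons_of_mem _ h'
    have ihq := ih hzw hp.1 he'
    cases q with
    | nil =>
      have hu₂ : IsUnitStep (dirOf (ofSite b) (ofSite w)) := isUnitStep_dirOf_of_adj hzw
      have hwa : w ≠ a' := by
        rintro rfl
        apply he
        simp [Sym2.eq_swap]
      have hdot : dotZ (dirOf (ofSite a') (ofSite b)) (dirOf (ofSite b) (ofSite w)) ≠ -1 :=
        fun h => hwa (eq_of_dotZ_eq_neg_one hu₁ hu₂ h)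
      simp [goodSteps, hu₁, hu₂, hdot]
    | @cons _ c _ hbc q' =>
      have hu₂ : IsUnitStep (dirOf (ofSite b) (ofSite c)) := isUnitStep_dirOf_of_adj (hG hbc)
      have hca : c ≠ a' := by
        rintro rfl
        exact hp.2 (by simp)
      have hdot : dotZ (dirOf (ofSite a') (ofSite b)) (dirOf (ofSite b) (ofSite c)) ≠ -1 :=
        fun h => hca (eq_of_dotZ_eq_neg_one hu₁ hu₂ h)
      obtain ⟨rest, hq'⟩ : ∃ rest, q'.support = c :: rest :=
        ⟨_, (SimpleGraph.Walk.cons_tail_support q').symm⟩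
      have hs' : (SimpleGraph.Walk.cons hbc q').support.map ofSite ++ [ofSite w] =
          ofSite b :: ofSite c :: (rest.map ofSite ++ [ofSite w]) := by
        rw [SimpleGraph.Walk.support_cons, hq']
        simp only [List.map_cons, List.cons_append]
      have hs : (SimpleGraph.Walk.cons hab (SimpleGraph.Walk.cons hbc q')).support.map ofSite ++ [ofSite w] =
          ofSite a' :: ofSite b :: ofSite c :: (rest.map ofSite ++ [ofSite w]) := by
        rw [SimpleGraph.Walk.support_cons, List.map_cons, List.cons_append, hs']
      rw [hs'] at ihq
      rw [hs]
      simp [goodSteps, hu₁, hdot, ihq]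

/-! ### The dictionary, walk by walk -/

/-- **`(-1)^{#turns} = e^{-2iW}`** for a self-avoiding walk of `Ω_δ` continued to the middle of a
fresh lattice edge `{z, w}` (`W` = "the total rotation of the direction in radians" of the
continued mesh polyline: on `ℤ²` every turn is `±π/2`, so turns and quarter windings have the
same parity). [cite: DuminilCopinSmirnov2012, §2 (winding `W_γ(a,z)`)] -/
theorem neg_one_pow_turnCount_eq_exp_winding {Ω : Set ℂ} {δ : ℝ} (hδ : δ ≠ 0) {a z : Site 2}
    (γ : DomainSAW Ω δ a z) (w : Site 2) (hzw : (zdGraph 2).Adj z w) (he : s(z, w) ∉ γ.walk.edges) :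
    ((-1 : ℂ) ^ turnCount (γ.walk.support ++ [w])) =
      Complex.exp (-Complex.I * 2 *
        ((winding (γ.walk.support.map (meshPoint δ) ++ [medialPoint δ s(z, w)]) : ℝ) : ℂ)) := by
  have hG : discreteDomainGraph Ω δ ≤ zdGraph 2 := fun x y h =>
    (meshGraph_adj_iff.1 (discreteDomainGraph_adj_iff.1 h).1).1
  have hgood := goodSteps_support_of_isPath hG γ.walk w hzw γ.isPath he
  have hgood' : goodSteps ((γ.walk.support ++ [w]).map ofSite) = true := by
    simpa [List.map_append] using hgood
  rw [neg_one_pow_turnCount _ hgood', winding_support_medial_eq_one γ.walk w hδ,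
    winding_support_medial γ.walk w hgood]
  congr 1
  simp only [List.map_append, List.map_cons, List.map_nil]
  push_cast
  ring

/-- **The dictionary, walk by walk.** For `u = -v` the stiffness weight of a walk at spin `σ`
is the uniform weight `v^{#vertices}` at spin `σ + 2`:
`e^{-iσW} (-v)^T v^S = e^{-i(σ+2)W} v^T v^S`. [folklore] -/
private theorem stiffnessWeight_antidiag {Ω : Set ℂ} {δ : ℝ} (hδ : δ ≠ 0) {a z : Site 2}
    (γ : DomainSAW Ω δ a z) (w : Site 2) (hzw : (zdGraph 2).Adj z w) (he : s(z, w) ∉ γ.walk.edges)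
    (v : ℂ) (σ : ℝ) :
    Complex.exp (-Complex.I * σ *
        ((winding (γ.walk.support.map (meshPoint δ) ++ [medialPoint δ s(z, w)]) : ℝ) : ℂ)) *
      ((-v) ^ turnCount (γ.walk.support ++ [w]) * v ^ straightCount (γ.walk.support ++ [w])) =
    Complex.exp (-Complex.I * ((σ + 2 : ℝ) : ℂ) *
        ((winding (γ.walk.support.map (meshPoint δ) ++ [medialPoint δ s(z, w)]) : ℝ) : ℂ)) *
      (v ^ turnCount (γ.walk.support ++ [w]) * v ^ straightCount (γ.walk.support ++ [w])) := by
  rw [neg_pow, neg_one_pow_turnCount_eq_exp_winding hδ γ w hzw he]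
  rw [show ((σ + 2 : ℝ) : ℂ) = (σ : ℂ) + 2 by push_cast; ring]
  rw [show -Complex.I * ((σ : ℂ) + 2) *
      ((winding (γ.walk.support.map (meshPoint δ) ++ [medialPoint δ s(z, w)]) : ℝ) : ℂ) =
      -Complex.I * σ * ((winding (γ.walk.support.map (meshPoint δ) ++ [medialPoint δ s(z, w)]) : ℝ) : ℂ) +
      -Complex.I * 2 * ((winding (γ.walk.support.map (meshPoint δ) ++ [medialPoint δ s(z, w)]) : ℝ) : ℂ) by ring,
    Complex.exp_add]
  ring

end NoVertexRelationStiffness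

/-! ### The dictionary for the observable and for the technique class

(declarations at the level of `NoExactVertexRelationZ2Stiffness_holds`, outside the helper namespace). -/

open NoVertexRelation NoVertexRelationStiffness Literature.Probability.RandomPlanarGeometry.SAW

/-- **The anti-diagonal is the uniform walk two spin units up** (half-edge terms): for every
`v : ℂ`, spin `σ`, mesh `δ ≠ 0` and lattice edge `{z, w}`,
`stiffnessHalfEdgeTerm Ω δ a (-v) v σ z w = stiffnessHalfEdgeTerm Ω δ a v v (σ + 2) z w`
(the `w₁ = w₂ = 0` slice `(1, u, u, v, 0, 0)` of the plaquette weights at `u = -v`).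
[cite: DuminilCopinSmirnov2012, Def. 1 (shape of the observable)]
[cite: Glazman2015WeightedSAW, (1.1)-(1.5) (plaquette weights)] -/
theorem stiffnessHalfEdgeTerm_antidiag (Ω : Set ℂ) {δ : ℝ} (hδ : δ ≠ 0) (a : Site 2) (v : ℂ)
    (σ : ℝ) {z w : Site 2} (hzw : (zdGraph 2).Adj z w) :
    stiffnessHalfEdgeTerm Ω δ a (-v) v σ z w = stiffnessHalfEdgeTerm Ω δ a v v (σ + 2) z w := by
  unfold stiffnessHalfEdgeTerm
  refine tsum_congr fun γ => ?_
  split_ifs with he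
  · rfl
  · exact stiffnessWeight_antidiag hδ γ w hzw he v σ

/-- **The anti-diagonal is the uniform walk two spin units up** (mid-edge observable), on every
lattice edge `{z, w}`. [cite: DuminilCopinSmirnov2012, Def. 1 (shape of the observable)]
[cite: Glazman2015WeightedSAW, (1.1)-(1.5) (plaquette weights)] -/
theorem stiffnessMidEdgeObservable_antidiag (Ω : Set ℂ) {δ : ℝ} (hδ : δ ≠ 0) (a : Site 2)
    (v : ℂ) (σ : ℝ) {z w : Site 2} (hzw : (zdGraph 2).Adj z w) :
    stiffnessMidEdgeObservable Ω δ a (-v) v σ s(z, w) =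
      stiffnessMidEdgeObservable Ω δ a v v (σ + 2) s(z, w) := by
  rw [stiffnessMidEdgeObservable_mk, stiffnessMidEdgeObservable_mk,
    stiffnessHalfEdgeTerm_antidiag Ω hδ a v σ hzw, stiffnessHalfEdgeTerm_antidiag Ω hδ a v σ hzw.symm]

/-! ### The technique class on the anti-diagonal -/

/-- The four lattice directions are unit steps of `ℤ²`: `v₀ ∼ v₀ + dirZ2 i`. [folklore] -/
private theorem zdGraph_adj_add_dirZ2 (v₀ : Site 2) (i : Fin 4) : (zdGraph 2).Adj v₀ (v₀ + dirZ2 i) := by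
  rw [zdGraph_adj_iff]
  fin_cases i
  · refine ⟨0, Or.inl ?_⟩
    funext j; fin_cases j <;> simp [dirZ2]
  · refine ⟨1, Or.inl ?_⟩
    funext j; fin_cases j <;> simp [dirZ2]
  · refine ⟨0, Or.inr ?_⟩
    funext j; fin_cases j <;> simp [dirZ2, Matrix.vecHead, Matrix.vecTail]
  · refine ⟨1, Or.inr ?_⟩
    funext j; fin_cases j <;> simp [dirZ2, Matrix.vecHead, Matrix.vecTail]

/-- **Dictionary for the technique class**: `c` is an exact vertex relation for the stiffness
observable at `(u, v) = (-v, v)` and spin `σ` iff it is one at `(v, v)` (the uniform walk of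
fugacity `v`) and spin `σ + 2`. [cite: Glazman2015WeightedSAW, Lemma 3.1 (the `σ`-classification of
the weighted walks; here its `w₁ = w₂ = 0` slice)] [cite: DuminilCopinSmirnov2012, Lemma 1 (shape of the relation)] -/
theorem exactVertexRelationZ2Stiffness_antidiag_iff (v : ℂ) (σ : ℝ) (c : Fin 4 → ℂ) :
    ExactVertexRelationZ2Stiffness (-v) v σ c ↔ ExactVertexRelationZ2Stiffness v v (σ + 2) c := by
  have key : ∀ (Ω : Set ℂ) (δ : ℝ) (a v₀ : Site 2), 0 < δ →
      ∑ i : Fin 4, c i * stiffnessMidEdgeObservable Ω δ a (-v) v σ s(v₀, v₀ + dirZ2 i) =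
        ∑ i : Fin 4, c i * stiffnessMidEdgeObservable Ω δ a v v (σ + 2) s(v₀, v₀ + dirZ2 i) := by
    intro Ω δ a v₀ hδ
    refine Finset.sum_congr rfl fun i _ => ?_
    rw [stiffnessMidEdgeObservable_antidiag Ω hδ.ne' a v σ (zdGraph_adj_add_dirZ2 v₀ i)]
  constructor
  · intro h Ω δ a v₀ hδ ha hb hv
    rw [← key Ω δ a v₀ hδ]
    exact h Ω δ a v₀ hδ ha hb hv
  · intro h Ω δ a v₀ hδ ha hb hv
    rw [key Ω δ a v₀ hδ]
    exact h Ω δ a v₀ hδ ha hb hv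

/-- **On the anti-diagonal the class IS Appendix A's class at the shifted spin**: for real
`x ≠ 0`, `ExactVertexRelationZ2Stiffness (-x) x σ c ↔ ExactVertexRelationZ2 x (σ + 2) c`.
[cite: DuminilCopin2013Parafermion, Remark 12.13 (the uniform walk is `(1, x, x, x, 0, 0)`)]
[cite: Glazman2015WeightedSAW, Lemma 3.1] -/
theorem exactVertexRelationZ2Stiffness_antidiag_iff_exactVertexRelationZ2 {x : ℝ} (hx : x ≠ 0)
    (σ : ℝ) (c : Fin 4 → ℂ) :
    ExactVertexRelationZ2Stiffness (-(x : ℂ)) x σ c ↔ ExactVertexRelationZ2 x (σ + 2) c := by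
  rw [exactVertexRelationZ2Stiffness_antidiag_iff, exactVertexRelationZ2Stiffness_diag_iff hx]

/-- **No exact vertex relation on the anti-diagonal `u = -v`, `v ∈ (0,1)`**: the stiffness
deformation at `(u, v) = (-x, x)`, `0 < x < 1`, admits no exact single-vertex relation with
vertex-independent coefficients at any real spin — it is the uniform walk of fugacity `x` at the
spin `σ + 2`, excluded by Appendix A (`exactVertexRelationZ2_eq_zero`). This discharges the
anti-diagonal half of `scope_caveats (a)` of `NoExactVertexRelationZ2Stiffness` (the other half,
`(x, -x)` with `0 < x`, is the uniform walk of NEGATIVE fugacity `-x`, not covered by Appendix A).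
[cite: Glazman2015WeightedSAW, Lemma 3.1] -/
theorem exactVertexRelationZ2Stiffness_eq_zero_antidiag {x σ : ℝ} {c : Fin 4 → ℂ} (hx0 : 0 < x)
    (hx1 : x < 1) (hrel : ExactVertexRelationZ2Stiffness (-(x : ℂ)) x σ c) : c = 0 :=
  exactVertexRelationZ2_eq_zero hx0 hx1
    ((exactVertexRelationZ2Stiffness_antidiag_iff_exactVertexRelationZ2 hx0.ne' σ c).1 hrel)

/-- **The stiffness class is empty on `{u v ≠ 0, u² ≠ v²} ∪ {(-x, x) : 0 < x < 1}`** (this file's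
anti-diagonal together with `NoExactVertexRelationZ2Stiffness_holds`). [cite: Glazman2015WeightedSAW, Lemma 3.1] -/
theorem exactVertexRelationZ2Stiffness_eq_zero_of_sq_ne_or_antidiag {u v : ℂ} {σ : ℝ}
    {c : Fin 4 → ℂ}
    (h : (u ≠ 0 ∧ v ≠ 0 ∧ u ^ 2 ≠ v ^ 2) ∨ (∃ x : ℝ, 0 < x ∧ x < 1 ∧ u = -(x : ℂ) ∧ v = x))
    (hrel : ExactVertexRelationZ2Stiffness u v σ c) : c = 0 := by
  rcases h with ⟨hu, hv, huv⟩ | ⟨x, hx0, hx1, rfl, rfl⟩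
  · exact NoExactVertexRelationZ2Stiffness_holds u v σ c hu hv huv hrel
  · exact exactVertexRelationZ2Stiffness_eq_zero_antidiag hx0 hx1 hrel

end Literature.Barriers.CriticalPhenomena

end
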